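import Summits.BirchSwinnertonDyer.BirchSwinnertonDyer.Theorems.ThetaPartnerAtTwoSignedKatoUpToAtTwoOfPubKatoFact
import HarnessLib

/-!
# Route `ResidualThetaTransportAtTwo` (RTT) reading of K3P′ `SignedKatoDivisibilityUpToAtTwoOfPub` (stmt-BirchSwinnertonDyer-25631),
# line `colemanrat` v16 — the by-name certificate over the ONE named Literature fact, on the SECOND route wanting the item

Width seat `bsd-wall-tp2-p2x-w2` g9 (cell `bsd-wall`). The lead's file `ThetaPartnerAtTwoSignedKatoUpToAtTwoOfPubKatoFact.lean` (p642700)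
carries the certificates `KatoBK.signedKatoDivisibilityUpToAtTwoOfPub_of_kato_tatePairing_fact` (the `ThetaPartnerAtTwo` decl of K3P′) and
`KatoBK.signedKatoDivisibilityUpToAtTwo_of_kato_facts_of_gzk` / `…_rtt_of_kato_facts_of_gzk` (K3 on both routes). The item
stmt-BirchSwinnertonDyer-25631 is ALSO wanted by `route-BirchSwinnertonDyer-ResidualThetaTransportAtTwo` under its own decl
`Summit.BirchSwinnertonDyer.BirchSwinnertonDyer.Theses.ResidualThetaTransportAtTwo.SignedKatoDivisibilityUpToAtTwoOfPub` (a byte-identical copy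
of the TP2 text; binder `hKatoP` of that route's closing assembly). This file supplies the missing reading: RTT-K3P′ ⟸
`Kato2004.exists_eulerSystem_expStar_tatePairing_values_two` BY NAME, and the RTT form of the route's own use `hKatoP hKES hGZK` (K3 on RTT from
RTT-K3P′ and the two PUB binders). HONEST FRAMING: compositions only (no definition, no named fact, no instance, no `sorry`); CONDITIONAL on the
displayed Literature fact(s), none proved in the tree; closes no item; K3 / K3P′ are NOT settled; BSD is NOT proved by any of this.
-/

set_option autoImplicit false
-- the Theorems namespace of this sub repeats the summit name by design (D-0017 nested layout)
set_option linter.dupNamespace false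

noncomputable section

open Literature.NumberTheory.EllipticCurves Literature.NumberTheory.EllipticCurves.Kato2004

namespace Summit.BirchSwinnertonDyer.BirchSwinnertonDyer.Theorems.SignedKatoOffTwo.KatoBK

/-- **RTT-K3P′ BY NAME ⟸ ONE NAMED LITERATURE FACT** (decl `Theses.ResidualThetaTransportAtTwo.SignedKatoDivisibilityUpToAtTwoOfPub`, item
stmt-BirchSwinnertonDyer-25631 as wanted by `route-BirchSwinnertonDyer-ResidualThetaTransportAtTwo`): Kato's `2`-adic zeta elements of `T₂E` with
their values and the layer Tate-pairing law (`Kato2004.exists_eulerSystem_expStar_tatePairing_values_two`) imply Kato's signed divisibility up to a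
`2`-power in its published-inputs form, read on the RTT route. The RTT decl is the TP2 decl's text verbatim, so the lead's TP2 certificate
`signedKatoDivisibilityUpToAtTwoOfPub_of_kato_tatePairing_fact` (p642700) is the proof term. CONDITIONAL on the displayed fact (unproved in the
tree); closes nothing by itself; BSD is not proved by this.
[cite: Kato2004Asterisque, Thm. 12.5 (1) (pp. 221–222), Ex. 13.3 (p. 225), Thm. 13.4 (2) (p. 226)] [cite: Rubin1998Durham, §5 display (2), Thm. 7.1]
[cite: Kobayashi2003, (8.23), (8.29), Prop. 8.25] -/
theorem signedKatoDivisibilityUpToAtTwoOfPub_rtt_of_kato_tatePairing_fact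
    (hF : Kato2004.exists_eulerSystem_expStar_tatePairing_values_two) :
    Summit.BirchSwinnertonDyer.BirchSwinnertonDyer.Theses.ResidualThetaTransportAtTwo.SignedKatoDivisibilityUpToAtTwoOfPub :=
  signedKatoDivisibilityUpToAtTwoOfPub_of_kato_tatePairing_fact hF

/-- **The RTT route's own use of its binder `hKatoP`, by name** (`have hKato := hKatoP hKES hGZK` of the RTT closing assembly): RTT-K3P′ together
with the two PUB binders Kato Thm. 13.4 (2) at `p = 2` (contragredient fine dual, `Kato2004.thm13_4_two_lengthAt_fineSelmerDualContra_le_of_isEulerSystemClassTwo`,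
= the alias item `KatoEulerSystemBoundContraAtTwoSupply`) and Gross–Zagier–Kolyvagin (`rank_eq_analyticRank_of_analyticRank_le_one`) gives K3 on the
RTT route (`Theses.ResidualThetaTransportAtTwo.SignedKatoDivisibilityUpToAtTwo`). Definitional unfolding only. CONDITIONAL; closes nothing by itself;
BSD is not proved by this. [cite: Kato2004Asterisque, Thm. 13.4 (2) (p. 226)] [cite: GrossZagier1986, Thm. I.6.3] [cite: Kolyvagin1990, Thm. A] -/
theorem signedKatoDivisibilityUpToAtTwo_rtt_of_ofPub_rtt
    (hKatoP : Summit.BirchSwinnertonDyer.BirchSwinnertonDyer.Theses.ResidualThetaTransportAtTwo.SignedKatoDivisibilityUpToAtTwoOfPub)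
    (hKES : Kato2004.thm13_4_two_lengthAt_fineSelmerDualContra_le_of_isEulerSystemClassTwo)
    (hGZK : rank_eq_analyticRank_of_analyticRank_le_one) :
    Summit.BirchSwinnertonDyer.BirchSwinnertonDyer.Theses.ResidualThetaTransportAtTwo.SignedKatoDivisibilityUpToAtTwo :=
  hKatoP hKES hGZK

end Summit.BirchSwinnertonDyer.BirchSwinnertonDyer.Theorems.SignedKatoOffTwo.KatoBK

end
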